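import Mathlib
import Literature.MathematicalPhysics.QuantumFieldTheory.PottsHiggsCellularRepresentationFKG
import Literature.MathematicalPhysics.QuantumFieldTheory.PlaquetteRandomClusterComparison
import HarnessLib

/-!
# The cellular representation of the Potts lattice Higgs model, IV: Theorem 13 (stochastic
# domination of the coupled plaquette percolation by, and of, independent Bernoulli percolation)
# — the Bernoulli sandwich `ψ_{p̂₂,p̂₁} ≤_st ρ_{p₂,p₁} ≤_st ψ_{p₂,p₁}` — PROVED

Source: P. Eldridge, M. P. Forsström, B. Schweinhart, *A Cellular Representation of the Potts
Lattice Higgs Model*, arXiv:2602.22199 (2026) [cite: EldridgeForsstromSchweinhart2026] (= EFS26):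
§1.2 **Theorem 13** ("`ρ_{p₂,p₁}` is stochastically dominated by independent Bernoulli percolation
with probabilities `p₂` on `(i+1)`-cells and `p₁` on `i`-cells, and stochastically dominates
percolation with probabilities `p₂/(q(1-p₂)+p₂)` and `p₁/(q(1-p₁)+p₁)` respectively. Furthermore,
when `q` is fixed, `ρ` is stochastically increasing in `p₂` and in `p₁`"), §4.3 Definition 22
(the auxiliary model `ρ̂_{p₂,p₁,r}`; `r = 1` is independent percolation), Theorem 23 (Holley's
theorem, [G06]), Proposition 24 and its proof (the one-point conditionals: "adding a single
`i`-cell to `Q` or a single `(i+1)`-cell to `P` adds a single linear equation and can thus either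
leave `b_i(P,Q;ℤ_q)` unchanged or decrease it by one", pp. 15–16).

Fourth file of the EFS26 transcription (`PottsHiggsCellularRepresentation` — Defs. 1–6, Thms. 5, 7;
`…FKG` — Lemma 21, Thm. 11, Props. 27–29 and the "increasing in `p₂, p₁`" clause of Thm. 13 for
events, `cppEventProb_mono_param`; `PottsHiggsCellularDualityThree` — Def. 14, Thm. 15, Prop. 25,
Lemma 26), same vocabulary (`PlaquetteRC`, torus `𝕋^d_L`, `i = 1`: `CppConfig d L` = (open
plaquettes, open edges), `relCocycleCard M ω = |Z¹(P₂,P₁;M)|`, `cppWeight`/`cppProb`/`cppEventProb`).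
Everything is a `theorem`; NO named fact is introduced.

GENERALITY. The coefficients are an arbitrary finite abelian group `M` (EFS26: `M = ℤ_q`, `q ≥ 1`
an integer), and `|M|` replaces `q` in the reduced parameters `p̂ᵢ = pᵢ/(pᵢ + |M|(1-pᵢ))` — the
tree's `PlaquetteRC.hatParam pᵢ |M|` of `PlaquetteRandomClusterComparison.lean` (the same reduced
parameter as in Duncan–Schweinhart's Lemma 32, reused, not re-declared). Independent Bernoulli
percolation `ψ_{p₂,p₁}` is the CPP with TRIVIAL coefficients `M = Unit` (`|Z¹| ≡ 1`,
`relCocycleCard_punit`; EFS26 Def. 22 with `r = 1`), so no new measure is defined either.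
Parameters `p₂, p₁ ∈ (0,1)` (EFS26: `[0,1]`; TODO(general form): the degenerate endpoints, where
`cppPartitionFn_pos` of the first file is not available as stated).

HONEST SCOPE. Finite-volume comparison inequalities between explicit probability vectors on the
finite distributive lattice `CppConfig d L`; "stochastic domination" is rendered as the ordering of
the expectations of all increasing non-negative functions (equivalently of all increasing events —
`cppEventProb_sandwich`), which on a finite lattice is Strassen-equivalent to the coupling
formulation EFS26 use; no coupling is constructed here. Nothing in this file bears on the Clay
Yang–Mills mass-gap problem; in this tree the route R4 closes only the conditional finite-`𝕋⁴` rung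
`BalabanLadder.UV`.

## What is proved

* `relCocycleCard_punit`, `cppWeight_punit`, `cppPartitionFn_punit` (`= 1`, binomial theorem twice),
  `cppProb_punit`: the `M = Unit` CPP is independent Bernoulli `(p₂, p₁)` percolation;
  `cppWeight_punit_mul`: its weights are modular (`B(a)B(b) = B(a⊓b)B(a⊔b)`).
* `relCocycleCard_anti` (`a ≤ b → |Z¹(b)| ≤ |Z¹(a)|`), `relCocycleCard_le_card_mul_insert_fst`
  (`|Z¹(P₂,P₁)| ≤ |M|·|Z¹(P₂∪{σ},P₁)|`, the plaquette companion of the edge bound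
  `relCocycleCard_le_card_mul_insert` of the FKG file — kernel of `θ ↦ (δθ)(σ)`),
  `relCocycleCard_le_pow_mul_union` / `_sup` (`|Z¹(b)| ≤ |M|^{|a∖b|}|Z¹(a⊔b)|`).
* The two Holley conditions `cppWeight_mul_bernoulli_le`
  (`w_M(a)B_p(b) ≤ w_M(a⊓b)B_p(a⊔b)`) and `bernoulli_hat_mul_cppWeight_le`
  (`B_{p̂}(a)w_M(b) ≤ B_{p̂}(a⊓b)w_M(a⊔b)`, using `(1-p̂)p = |M| p̂ (1-p)`, `hatParam_mem_Ioo_and`).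
* **Theorem 13**: `sum_mul_cppProb_le_bernoulli` (`ρ_{M,p₂,p₁}(X) ≤ ψ_{p₂,p₁}(X)`) and
  `sum_mul_bernoulli_hat_le_cppProb` (`ψ_{p̂₂,p̂₁}(X) ≤ ρ_{M,p₂,p₁}(X)`) for increasing `X ≥ 0`, by
  Mathlib's four-functions `holley`; `cppEventProb_sandwich`: for increasing events `E`,
  `ψ_{p̂₂,p̂₁}(E) ≤ ρ_{M,p₂,p₁}(E) ≤ ψ_{p₂,p₁}(E)`.
-/

open Finset

namespace Literature.MathematicalPhysics.QuantumFieldTheory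

namespace PlaquetteRC

open LatticeForm

variable {d L : ℕ}

/-! ### `q = 1`: trivial coefficients give independent Bernoulli percolation on plaquettes and edges -/

section Bernoulli

variable [NeZero L]

omit [NeZero L] in
/-- With trivial coefficients every pair is compatible with exactly one cochain:
`|Z¹(P₂, P₁; 0)| = 1`. [cite: EldridgeForsstromSchweinhart2026, §4.3 Def. 22 (r = 1: "ρ̂ is independent percolation")] -/
theorem relCocycleCard_punit (ω : CppConfig d L) : relCocycleCard Unit ω = 1 := by
  unfold relCocycleCard
  exact Nat.card_unique

/-- **The CPP with trivial coefficients is independent Bernoulli percolation** with probability `p₂`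
on plaquettes and `p₁` on edges: its weight is `p₂^{|P₂|}(1-p₂)^{|P₂ᶜ|} p₁^{|P₁|}(1-p₁)^{|P₁ᶜ|}`.
[cite: EldridgeForsstromSchweinhart2026, §4.3 Def. 22 (r = 1) and §4.2 Prop. 20 (q = 1 is Bernoulli plaquette percolation)] -/
theorem cppWeight_punit (p₂ p₁ : ℝ) (ω : CppConfig d L) :
    cppWeight Unit p₂ p₁ ω =
      p₂ ^ ω.1.card * (1 - p₂) ^ ω.1ᶜ.card * (p₁ ^ ω.2.card * (1 - p₁) ^ ω.2ᶜ.card) := by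
  unfold cppWeight
  rw [relCocycleCard_punit, Nat.cast_one, mul_one]

/-- The Bernoulli weights sum to `1`. [cite: EldridgeForsstromSchweinhart2026, §4.3 Def. 22 (r = 1)] -/
theorem cppPartitionFn_punit (p₂ p₁ : ℝ) : cppPartitionFn (d := d) (L := L) Unit p₂ p₁ = 1 := by
  classical
  unfold cppPartitionFn
  simp_rw [cppWeight_punit]
  rw [Fintype.sum_prod_type]
  simp_rw [← Finset.mul_sum, ← Finset.sum_mul]
  have h2 := Fintype.sum_pow_mul_eq_add_pow (Plaquette d L) p₂ (1 - p₂)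
  have h1 := Fintype.sum_pow_mul_eq_add_pow (Site d L × Fin d) p₁ (1 - p₁)
  rw [add_sub_cancel, one_pow] at h2 h1
  have e2 : ∑ A : Finset (Plaquette d L), p₂ ^ A.card * (1 - p₂) ^ Aᶜ.card = 1 := by
    simp_rw [Finset.card_compl]; exact h2
  have e1 : ∑ B : Finset (Site d L × Fin d), p₁ ^ B.card * (1 - p₁) ^ Bᶜ.card = 1 := by
    simp_rw [Finset.card_compl]; exact h1
  rw [e2, e1, mul_one]

/-- Hence the Bernoulli probability of a configuration is its weight. [cite: EldridgeForsstromSchweinhart2026, §4.3 Def. 22 (r = 1)] -/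
theorem cppProb_punit (p₂ p₁ : ℝ) (ω : CppConfig d L) :
    cppProb Unit p₂ p₁ ω =
      p₂ ^ ω.1.card * (1 - p₂) ^ ω.1ᶜ.card * (p₁ ^ ω.2.card * (1 - p₁) ^ ω.2ᶜ.card) := by
  unfold cppProb
  rw [cppPartitionFn_punit, div_one, cppWeight_punit]

/-- **Modularity of the Bernoulli weights**: `B(a) B(b) = B(a ⊓ b) B(a ⊔ b)` (the four cell counts
are modular). [cite: EldridgeForsstromSchweinhart2026, §4.2 (proof of Thm. 11: the r-independent factors)] -/
theorem cppWeight_punit_mul (p₂ p₁ : ℝ) (a b : CppConfig d L) :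
    cppWeight Unit p₂ p₁ a * cppWeight Unit p₂ p₁ b =
      cppWeight Unit p₂ p₁ (a ⊓ b) * cppWeight Unit p₂ p₁ (a ⊔ b) := by
  classical
  have hc1 : a.1.card + b.1.card = (a ⊓ b).1.card + (a ⊔ b).1.card := by
    rw [Prod.fst_inf, Prod.fst_sup, Finset.inf_eq_inter, Finset.sup_eq_union,
      Finset.card_inter_add_card_union]
  have hc1c : a.1ᶜ.card + b.1ᶜ.card = (a ⊓ b).1ᶜ.card + (a ⊔ b).1ᶜ.card := by
    rw [Prod.fst_inf, Prod.fst_sup, Finset.inf_eq_inter, Finset.sup_eq_union, Finset.compl_inter,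
      Finset.compl_union, add_comm ((a.1ᶜ ∪ b.1ᶜ).card), Finset.card_inter_add_card_union]
  have hc2 : a.2.card + b.2.card = (a ⊓ b).2.card + (a ⊔ b).2.card := by
    rw [Prod.snd_inf, Prod.snd_sup, Finset.inf_eq_inter, Finset.sup_eq_union,
      Finset.card_inter_add_card_union]
  have hc2c : a.2ᶜ.card + b.2ᶜ.card = (a ⊓ b).2ᶜ.card + (a ⊔ b).2ᶜ.card := by
    rw [Prod.snd_inf, Prod.snd_sup, Finset.inf_eq_inter, Finset.sup_eq_union, Finset.compl_inter,
      Finset.compl_union, add_comm ((a.2ᶜ ∪ b.2ᶜ).card), Finset.card_inter_add_card_union]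
  simp only [cppWeight_punit]
  calc p₂ ^ a.1.card * (1 - p₂) ^ a.1ᶜ.card * (p₁ ^ a.2.card * (1 - p₁) ^ a.2ᶜ.card) *
        (p₂ ^ b.1.card * (1 - p₂) ^ b.1ᶜ.card * (p₁ ^ b.2.card * (1 - p₁) ^ b.2ᶜ.card))
      = p₂ ^ (a.1.card + b.1.card) * (1 - p₂) ^ (a.1ᶜ.card + b.1ᶜ.card) *
          (p₁ ^ (a.2.card + b.2.card) * (1 - p₁) ^ (a.2ᶜ.card + b.2ᶜ.card)) := by ring
    _ = p₂ ^ ((a ⊓ b).1.card + (a ⊔ b).1.card) * (1 - p₂) ^ ((a ⊓ b).1ᶜ.card + (a ⊔ b).1ᶜ.card) *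
          (p₁ ^ ((a ⊓ b).2.card + (a ⊔ b).2.card) *
            (1 - p₁) ^ ((a ⊓ b).2ᶜ.card + (a ⊔ b).2ᶜ.card)) := by rw [hc1, hc1c, hc2, hc2c]
    _ = _ := by ring

end Bernoulli

/-! ### Cocycle counts: antitone, and one more open cell costs at most a factor `|M|` -/

section Counts

variable [NeZero L] (M : Type*) [AddCommGroup M] [Fintype M]

/-- `Z¹` is antitone in the configuration, hence so is its cardinality: `a ≤ b → |Z¹(b)| ≤ |Z¹(a)|`.
[cite: EldridgeForsstromSchweinhart2026, §4.3 (proof of Prop. 24: adding a cell adds a linear equation)] -/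
theorem relCocycleCard_anti {a b : CppConfig d L} (h : a ≤ b) :
    relCocycleCard M b ≤ relCocycleCard M a := by
  unfold relCocycleCard
  haveI : Finite (relFlatCochains (d := d) (L := L) ℤ M a) := Subtype.finite
  exact Nat.card_le_card_of_injective _ (Submodule.inclusion_injective (relFlatCochains_antitone h))

omit [NeZero L] in
/-- **One more open plaquette costs at most a factor `|M|`**:
`|Z¹(P₂, P₁; M)| ≤ |M| · |Z¹(P₂ ∪ {σ}, P₁; M)|` — `Z¹(P₂ ∪ {σ}, P₁)` is the kernel of
`θ ↦ (δθ)(σ)` on `Z¹(P₂, P₁)`, whose image has at most `|M|` elements ("adding a single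
`(i+1)`-cell to `P` adds a single linear equation"). [cite: EldridgeForsstromSchweinhart2026, §4.3 (proof of Prop. 24)] -/
theorem relCocycleCard_le_card_mul_insert_fst (ω : CppConfig d L) (σ : Plaquette d L) :
    relCocycleCard M ω ≤ Fintype.card M * relCocycleCard M (insert σ ω.1, ω.2) := by
  classical
  set Z := relFlatCochains (d := d) (L := L) ℤ M ω with hZdef
  set Z' := relFlatCochains (d := d) (L := L) ℤ M (insert σ ω.1, ω.2) with hZ'def
  -- `θ ↦ (δθ)(σ)` as a `ℤ`-linear map
  set ev : (Site d L → Fin d → M) →ₗ[ℤ] M :=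
    { toFun := fun θ => res (td₁ θ) σ
      map_add' := fun a b => by
        have h := congrArg (fun η => res η σ) (td₁_add a b)
        simp only [res, Pi.add_apply] at h ⊢
        exact h
      map_smul' := fun c θ => by
        have h := congrArg (fun η => res η σ) (td₁_smul (R := ℤ) c θ)
        simp only [res, Pi.smul_apply, RingHom.id_apply] at h ⊢
        exact h } with hev
  set f : Z →ₗ[ℤ] M := ev.comp Z.subtype with hf
  have hfapply : ∀ z : Z, f z = res (td₁ (z : Site d L → Fin d → M)) σ := fun z => rfl
  have hker : ∀ z : Z, z ∈ LinearMap.ker f ↔ res (td₁ (z : Site d L → Fin d → M)) σ = 0 :=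
    fun z => by rw [LinearMap.mem_ker, hfapply]
  have φ : LinearMap.ker f ≃ Z' :=
  { toFun := fun z => ⟨(z.1 : Site d L → Fin d → M), ⟨fun τ hτ => by
        rcases Finset.mem_insert.mp hτ with rfl | hτ
        · exact (hker z.1).mp z.2
        · exact z.1.2.1 τ hτ, z.1.2.2⟩⟩
    invFun := fun θ => ⟨⟨θ.1, ⟨fun τ hτ => θ.2.1 τ (Finset.mem_insert_of_mem hτ), θ.2.2⟩⟩,
        (hker _).mpr (θ.2.1 σ (Finset.mem_insert_self σ ω.1))⟩
    left_inv := fun _ => rfl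
    right_inv := fun _ => rfl }
  have h1 : Nat.card Z = Nat.card (LinearMap.ker f) * Nat.card (Z ⧸ LinearMap.ker f) :=
    Submodule.card_eq_card_quotient_mul_card _
  have h2 : Nat.card (Z ⧸ LinearMap.ker f) = Nat.card (LinearMap.range f) :=
    Nat.card_congr f.quotKerEquivRange.toEquiv
  have h3 : Nat.card (LinearMap.range f) ≤ Fintype.card M := by
    rw [← Nat.card_eq_fintype_card]
    exact Nat.card_le_card_of_injective (fun x : LinearMap.range f => (x : M)) Subtype.val_injective
  have h4 : Nat.card (LinearMap.ker f) = Nat.card Z' := Nat.card_congr φ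
  show Nat.card Z ≤ Fintype.card M * Nat.card Z'
  rw [h1, h4, h2, mul_comm]
  exact Nat.mul_le_mul_right _ h3

omit [NeZero L] in
/-- **Opening `|S| + |T|` more cells costs at most `|M|^{|S|+|T|}`**:
`|Z¹(P₂, P₁)| ≤ |M|^{|S|+|T|} · |Z¹(P₂ ∪ S, P₁ ∪ T)|`. [cite: EldridgeForsstromSchweinhart2026, §4.3 (proof of Prop. 24)] -/
theorem relCocycleCard_le_pow_mul_union (ω : CppConfig d L) (S : Finset (Plaquette d L))
    (T : Finset (Site d L × Fin d)) :
    relCocycleCard M ω ≤ Fintype.card M ^ (S.card + T.card) * relCocycleCard M (ω.1 ∪ S, ω.2 ∪ T) := by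
  classical
  -- first the edges, then the plaquettes
  have hT : ∀ (P : Finset (Plaquette d L)) (T : Finset (Site d L × Fin d)) (Q : Finset (Site d L × Fin d)),
      relCocycleCard (d := d) (L := L) M (P, Q) ≤
        Fintype.card M ^ T.card * relCocycleCard (d := d) (L := L) M (P, Q ∪ T) := by
    intro P T
    induction T using Finset.induction_on with
    | empty => intro Q; simp
    | @insert e T he ih =>
      intro Q
      rw [Finset.card_insert_of_notMem he, pow_succ, Finset.union_insert]
      calc relCocycleCard M (P, Q) ≤ Fintype.card M ^ T.card * relCocycleCard M (P, Q ∪ T) := ih Q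
        _ ≤ Fintype.card M ^ T.card * (Fintype.card M * relCocycleCard M (P, insert e (Q ∪ T))) :=
          Nat.mul_le_mul_left _ (relCocycleCard_le_card_mul_insert M (P, Q ∪ T) e)
        _ = Fintype.card M ^ T.card * Fintype.card M * relCocycleCard M (P, insert e (Q ∪ T)) := by
          ring
  have hS : ∀ (S P : Finset (Plaquette d L)) (Q : Finset (Site d L × Fin d)),
      relCocycleCard (d := d) (L := L) M (P, Q) ≤
        Fintype.card M ^ S.card * relCocycleCard (d := d) (L := L) M (P ∪ S, Q) := by
    intro S
    induction S using Finset.induction_on with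
    | empty => intro P Q; simp
    | @insert σ S hσ ih =>
      intro P Q
      rw [Finset.card_insert_of_notMem hσ, pow_succ, Finset.union_insert]
      calc relCocycleCard M (P, Q) ≤ Fintype.card M ^ S.card * relCocycleCard M (P ∪ S, Q) := ih P Q
        _ ≤ Fintype.card M ^ S.card * (Fintype.card M * relCocycleCard M (insert σ (P ∪ S), Q)) :=
          Nat.mul_le_mul_left _ (relCocycleCard_le_card_mul_insert_fst M (P ∪ S, Q) σ)
        _ = Fintype.card M ^ S.card * Fintype.card M * relCocycleCard M (insert σ (P ∪ S), Q) := by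
          ring
  calc relCocycleCard M ω = relCocycleCard M (ω.1, ω.2) := rfl
    _ ≤ Fintype.card M ^ S.card * relCocycleCard M (ω.1 ∪ S, ω.2) := hS S ω.1 ω.2
    _ ≤ Fintype.card M ^ S.card * (Fintype.card M ^ T.card * relCocycleCard M (ω.1 ∪ S, ω.2 ∪ T)) :=
        Nat.mul_le_mul_left _ (hT _ T ω.2)
    _ = Fintype.card M ^ (S.card + T.card) * relCocycleCard M (ω.1 ∪ S, ω.2 ∪ T) := by
        rw [pow_add]; ring

omit [NeZero L] in
/-- The form used in the Holley condition: `|Z¹(b)| ≤ |M|^{|a.1 ∖ b.1| + |a.2 ∖ b.2|} |Z¹(a ⊔ b)|`.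
[cite: EldridgeForsstromSchweinhart2026, §4.3 (proof of Prop. 24)] -/
theorem relCocycleCard_le_pow_mul_sup (a b : CppConfig d L) :
    relCocycleCard M b ≤
      Fintype.card M ^ ((a.1 \ b.1).card + (a.2 \ b.2).card) * relCocycleCard M (a ⊔ b) := by
  classical
  have h := relCocycleCard_le_pow_mul_union M b (a.1 \ b.1) (a.2 \ b.2)
  have e : ((b.1 ∪ (a.1 \ b.1), b.2 ∪ (a.2 \ b.2)) : CppConfig d L) = a ⊔ b :=
    Prod.ext (show b.1 ∪ (a.1 \ b.1) = (a ⊔ b).1 by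
        rw [Prod.fst_sup, Finset.sup_eq_union, Finset.union_sdiff_self_eq_union, Finset.union_comm])
      (show b.2 ∪ (a.2 \ b.2) = (a ⊔ b).2 by
        rw [Prod.snd_sup, Finset.sup_eq_union, Finset.union_sdiff_self_eq_union, Finset.union_comm])
  rwa [e] at h

end Counts

/-! ### Theorem 13: the Holley conditions and the Bernoulli sandwich -/

section Sandwich

variable [NeZero L] (M : Type*) [AddCommGroup M] [Fintype M]

/-- **Holley condition, upper comparison**: `w_M(a) · B_{p₂,p₁}(b) ≤ w_M(a ⊓ b) · B_{p₂,p₁}(a ⊔ b)`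
(`|Z¹|` is antitone and the Bernoulli weights are modular). [cite: EldridgeForsstromSchweinhart2026, §4.3 Prop. 24 (proof: ρ̂ decreasing in r) and Thm. 23 (Holley)] -/
theorem cppWeight_mul_bernoulli_le {p₂ p₁ : ℝ} (hp₂ : p₂ ∈ Set.Icc (0 : ℝ) 1)
    (hp₁ : p₁ ∈ Set.Icc (0 : ℝ) 1) (a b : CppConfig d L) :
    cppWeight M p₂ p₁ a * cppWeight Unit p₂ p₁ b ≤
      cppWeight M p₂ p₁ (a ⊓ b) * cppWeight Unit p₂ p₁ (a ⊔ b) := by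
  have hZ : (relCocycleCard (d := d) (L := L) M a : ℝ) ≤ relCocycleCard (d := d) (L := L) M (a ⊓ b) := by
    exact_mod_cast relCocycleCard_anti M (inf_le_left : a ⊓ b ≤ a)
  have hBab := cppWeight_punit_mul p₂ p₁ a b
  have hB0 : 0 ≤ cppWeight (d := d) (L := L) Unit p₂ p₁ (a ⊓ b) * cppWeight Unit p₂ p₁ (a ⊔ b) :=
    mul_nonneg (cppWeight_nonneg Unit hp₂ hp₁ _) (cppWeight_nonneg Unit hp₂ hp₁ _)
  -- `w_M(ω) = B(ω) · |Z¹(ω)|`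
  have hfac : ∀ ω : CppConfig d L, cppWeight (d := d) (L := L) M p₂ p₁ ω =
      cppWeight Unit p₂ p₁ ω * relCocycleCard M ω := fun ω => by
    rw [cppWeight_punit]; rfl
  rw [hfac a, hfac (a ⊓ b)]
  calc cppWeight Unit p₂ p₁ a * (relCocycleCard M a : ℝ) * cppWeight Unit p₂ p₁ b
      = cppWeight Unit p₂ p₁ (a ⊓ b) * cppWeight Unit p₂ p₁ (a ⊔ b) * relCocycleCard M a := by
        rw [← hBab]; ring
    _ ≤ cppWeight Unit p₂ p₁ (a ⊓ b) * cppWeight Unit p₂ p₁ (a ⊔ b) * relCocycleCard M (a ⊓ b) :=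
        mul_le_mul_of_nonneg_left hZ hB0
    _ = _ := by ring

/-- For `p ∈ (0,1)` and `n ≥ 1` the reduced parameter `p̂ = p/(p + n(1-p))` (the tree's
`PlaquetteRC.hatParam p n`; EFS26 writes `p/(q(1-p)+p)`) lies in `(0,1)` and satisfies
`(1 - p̂) p = n · p̂ (1-p)`. [cite: EldridgeForsstromSchweinhart2026, §1.2 Thm. 13 and §4.3 (proof of Prop. 24: the one-point conditionals)] -/
theorem hatParam_mem_Ioo_and {p n : ℝ} (hp : p ∈ Set.Ioo (0 : ℝ) 1) (hn : 1 ≤ n) :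
    hatParam p n ∈ Set.Ioo (0 : ℝ) 1 ∧ (1 - hatParam p n) * p = n * (hatParam p n * (1 - p)) := by
  have h1 : 0 < 1 - p := sub_pos.mpr hp.2
  have hden : 0 < p + n * (1 - p) := by nlinarith [hp.1]
  unfold hatParam
  refine ⟨⟨div_pos hp.1 hden, by rw [div_lt_one hden]; nlinarith [hp.2]⟩, ?_⟩
  field_simp
  ring

/-- **Holley condition, lower comparison**: with `p̂ᵢ = pᵢ/(pᵢ + |M|(1-pᵢ))`,
`B_{p̂₂,p̂₁}(a) · w_M(b) ≤ B_{p̂₂,p̂₁}(a ⊓ b) · w_M(a ⊔ b)` — each of the `|a ∖ b|` added cells costs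
at most a factor `|M|` in `|Z¹|`, and `p̂/(1-p̂) = p/(|M|(1-p))`.
[cite: EldridgeForsstromSchweinhart2026, §4.3 Prop. 24 (proof: one-point conditionals ≥ p/(r(1-p)+p)) and Thm. 23 (Holley)] -/
theorem bernoulli_hat_mul_cppWeight_le {p₂ p₁ : ℝ} (hp₂ : p₂ ∈ Set.Ioo (0 : ℝ) 1)
    (hp₁ : p₁ ∈ Set.Ioo (0 : ℝ) 1) (a b : CppConfig d L) :
    cppWeight Unit (hatParam p₂ (Fintype.card M)) (hatParam p₁ (Fintype.card M)) a *
        cppWeight M p₂ p₁ b ≤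
      cppWeight Unit (hatParam p₂ (Fintype.card M)) (hatParam p₁ (Fintype.card M)) (a ⊓ b) *
        cppWeight M p₂ p₁ (a ⊔ b) := by
  classical
  set n : ℝ := (Fintype.card M : ℝ) with hn
  have hn1 : (1 : ℝ) ≤ n := by
    rw [hn]; exact_mod_cast Fintype.card_pos
  have hn0 : (0 : ℝ) ≤ n := zero_le_one.trans hn1
  obtain ⟨hP₂, key₂⟩ := hatParam_mem_Ioo_and hp₂ hn1
  obtain ⟨hP₁, key₁⟩ := hatParam_mem_Ioo_and hp₁ hn1
  set P₂ := hatParam p₂ n with hP₂def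
  set P₁ := hatParam p₁ n with hP₁def
  have h2 : 0 < 1 - p₂ := sub_pos.mpr hp₂.2
  have h1 : 0 < 1 - p₁ := sub_pos.mpr hp₁.2
  -- cardinalities: `k₂ = |a.1 \ b.1|`, `k₁ = |a.2 \ b.2|`
  set k₂ := (a.1 \ b.1).card with hk₂
  set k₁ := (a.2 \ b.2).card with hk₁
  have hca2 : a.1.card = (a ⊓ b).1.card + k₂ := by
    rw [Prod.fst_inf, Finset.inf_eq_inter]
    have := Finset.card_sdiff_add_card_inter a.1 b.1; omega
  have hcu2 : (a ⊔ b).1.card = b.1.card + k₂ := by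
    rw [Prod.fst_sup, Finset.sup_eq_union, hk₂, ← Finset.card_union_of_disjoint
      (Finset.disjoint_sdiff (s := b.1) (t := a.1)), Finset.union_sdiff_self_eq_union, Finset.union_comm]
  have hcac2 : (a ⊓ b).1ᶜ.card = a.1ᶜ.card + k₂ := by
    rw [Prod.fst_inf, Finset.inf_eq_inter]
    have := Finset.card_compl (a.1 ∩ b.1); have := Finset.card_compl a.1
    have : (a.1 ∩ b.1).card ≤ a.1.card := Finset.card_le_card Finset.inter_subset_left
    have : a.1.card ≤ Fintype.card (Plaquette d L) := Finset.card_le_univ a.1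
    have := Finset.card_sdiff_add_card_inter a.1 b.1
    omega
  have hcbc2 : b.1ᶜ.card = (a ⊔ b).1ᶜ.card + k₂ := by
    rw [Prod.fst_sup, Finset.sup_eq_union]
    have := Finset.card_compl (a.1 ∪ b.1); have := Finset.card_compl b.1
    have : (a.1 ∪ b.1).card ≤ Fintype.card (Plaquette d L) := Finset.card_le_univ _
    have h' : (a.1 ∪ b.1).card = b.1.card + k₂ := by
      rw [hk₂, ← Finset.card_union_of_disjoint (Finset.disjoint_sdiff (s := b.1) (t := a.1)),
        Finset.union_sdiff_self_eq_union, Finset.union_comm]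
    omega
  have hca1 : a.2.card = (a ⊓ b).2.card + k₁ := by
    rw [Prod.snd_inf, Finset.inf_eq_inter]
    have := Finset.card_sdiff_add_card_inter a.2 b.2; omega
  have hcu1 : (a ⊔ b).2.card = b.2.card + k₁ := by
    rw [Prod.snd_sup, Finset.sup_eq_union, hk₁, ← Finset.card_union_of_disjoint
      (Finset.disjoint_sdiff (s := b.2) (t := a.2)), Finset.union_sdiff_self_eq_union, Finset.union_comm]
  have hcac1 : (a ⊓ b).2ᶜ.card = a.2ᶜ.card + k₁ := by
    rw [Prod.snd_inf, Finset.inf_eq_inter]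
    have := Finset.card_compl (a.2 ∩ b.2); have := Finset.card_compl a.2
    have : (a.2 ∩ b.2).card ≤ a.2.card := Finset.card_le_card Finset.inter_subset_left
    have : a.2.card ≤ Fintype.card (Site d L × Fin d) := Finset.card_le_univ a.2
    have := Finset.card_sdiff_add_card_inter a.2 b.2
    omega
  have hcbc1 : b.2ᶜ.card = (a ⊔ b).2ᶜ.card + k₁ := by
    rw [Prod.snd_sup, Finset.sup_eq_union]
    have := Finset.card_compl (a.2 ∪ b.2); have := Finset.card_compl b.2
    have : (a.2 ∪ b.2).card ≤ Fintype.card (Site d L × Fin d) := Finset.card_le_univ _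
    have h' : (a.2 ∪ b.2).card = b.2.card + k₁ := by
      rw [hk₁, ← Finset.card_union_of_disjoint (Finset.disjoint_sdiff (s := b.2) (t := a.2)),
        Finset.union_sdiff_self_eq_union, Finset.union_comm]
    omega
  -- the cocycle counts: `|Z¹(b)| ≤ n^{k₂+k₁} |Z¹(a ⊔ b)|`
  have hZ : (relCocycleCard (d := d) (L := L) M b : ℝ) ≤
      n ^ (k₂ + k₁) * relCocycleCard (d := d) (L := L) M (a ⊔ b) := by
    rw [hn]; exact_mod_cast relCocycleCard_le_pow_mul_sup M a b
  -- the key scalar identities raised to the powers `k₂`, `k₁`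
  have key₂k : (1 - P₂) ^ k₂ * p₂ ^ k₂ = n ^ k₂ * (P₂ ^ k₂ * (1 - p₂) ^ k₂) := by
    have := congrArg (fun x : ℝ => x ^ k₂) key₂; simpa only [mul_pow] using this
  have key₁k : (1 - P₁) ^ k₁ * p₁ ^ k₁ = n ^ k₁ * (P₁ ^ k₁ * (1 - p₁) ^ k₁) := by
    have := congrArg (fun x : ℝ => x ^ k₁) key₁; simpa only [mul_pow] using this
  have hP₂0 : 0 ≤ P₂ := hP₂.1.le
  have hQ₂0 : 0 ≤ 1 - P₂ := sub_nonneg.mpr hP₂.2.le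
  have hP₁0 : 0 ≤ P₁ := hP₁.1.le
  have hQ₁0 : 0 ≤ 1 - P₁ := sub_nonneg.mpr hP₁.2.le
  unfold cppWeight
  rw [relCocycleCard_punit, relCocycleCard_punit, Nat.cast_one, mul_one, mul_one, hca2, hcu2, hcac2,
    hcbc2, hca1, hcu1, hcac1, hcbc1]
  -- common non-negative factor
  have hC : 0 ≤ P₂ ^ (a ⊓ b).1.card * (1 - P₂) ^ a.1ᶜ.card * (P₁ ^ (a ⊓ b).2.card * (1 - P₁) ^ a.2ᶜ.card) *
      (p₂ ^ b.1.card * (1 - p₂) ^ (a ⊔ b).1ᶜ.card * (p₁ ^ b.2.card * (1 - p₁) ^ (a ⊔ b).2ᶜ.card)) *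
      (P₂ ^ k₂ * (1 - p₂) ^ k₂ * (P₁ ^ k₁ * (1 - p₁) ^ k₁)) := by
    have := hp₂.1.le; have := hp₁.1.le; have := h2.le; have := h1.le
    positivity
  calc _ = P₂ ^ (a ⊓ b).1.card * (1 - P₂) ^ a.1ᶜ.card * (P₁ ^ (a ⊓ b).2.card * (1 - P₁) ^ a.2ᶜ.card) *
          (p₂ ^ b.1.card * (1 - p₂) ^ (a ⊔ b).1ᶜ.card * (p₁ ^ b.2.card * (1 - p₁) ^ (a ⊔ b).2ᶜ.card)) *
          (P₂ ^ k₂ * (1 - p₂) ^ k₂ * (P₁ ^ k₁ * (1 - p₁) ^ k₁)) * (relCocycleCard M b : ℝ) := by ring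
    _ ≤ P₂ ^ (a ⊓ b).1.card * (1 - P₂) ^ a.1ᶜ.card * (P₁ ^ (a ⊓ b).2.card * (1 - P₁) ^ a.2ᶜ.card) *
          (p₂ ^ b.1.card * (1 - p₂) ^ (a ⊔ b).1ᶜ.card * (p₁ ^ b.2.card * (1 - p₁) ^ (a ⊔ b).2ᶜ.card)) *
          (P₂ ^ k₂ * (1 - p₂) ^ k₂ * (P₁ ^ k₁ * (1 - p₁) ^ k₁)) *
          (n ^ (k₂ + k₁) * relCocycleCard M (a ⊔ b)) :=
        mul_le_mul_of_nonneg_left hZ hC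
    _ = _ := by
        linear_combination (-(P₂ ^ (a ⊓ b).1.card * (1 - P₂) ^ a.1ᶜ.card *
            (P₁ ^ (a ⊓ b).2.card * (1 - P₁) ^ a.2ᶜ.card) *
            (p₂ ^ b.1.card * (1 - p₂) ^ (a ⊔ b).1ᶜ.card * (p₁ ^ b.2.card * (1 - p₁) ^ (a ⊔ b).2ᶜ.card)) *
            (relCocycleCard M (a ⊔ b) : ℝ))) *
          (((1 - P₁) ^ k₁ * p₁ ^ k₁) * key₂k + (n ^ k₂ * (P₂ ^ k₂ * (1 - p₂) ^ k₂)) * key₁k)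

/-- **Theorem 13 (Eldridge–Forsström–Schweinhart), upper half, PROVED — `ρ_{p₂,p₁} ≤_st` Bernoulli
`(p₂, p₁)`**: on the torus with `i = 1`, coefficients in a finite abelian group `M` (EFS26:
`M = ℤ_q`), `p₂, p₁ ∈ (0,1)`: for every increasing non-negative function `X` of the pair
`(P₂, P₁)`, `Σ_ω X(ω) ρ_M(ω) ≤ Σ_ω X(ω) ψ_{p₂,p₁}(ω)`, where `ψ_{p₂,p₁} = ρ_{Unit}` is independent
Bernoulli percolation with probabilities `p₂` on plaquettes and `p₁` on edges. By Holley's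
inequality (Mathlib's four-functions `holley`).
[cite: EldridgeForsstromSchweinhart2026, §1.2 Thm. 13 and §4.3 (Def. 22, Thm. 23, Prop. 24)] -/
theorem sum_mul_cppProb_le_bernoulli {p₂ p₁ : ℝ} (hp₂ : p₂ ∈ Set.Ioo (0 : ℝ) 1)
    (hp₁ : p₁ ∈ Set.Ioo (0 : ℝ) 1) {X : CppConfig d L → ℝ} (hX₀ : 0 ≤ X) (hX : Monotone X) :
    ∑ ω, X ω * cppProb M p₂ p₁ ω ≤ ∑ ω, X ω * cppProb Unit p₂ p₁ ω := by
  classical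
  have hp₂' : p₂ ∈ Set.Icc (0 : ℝ) 1 := ⟨hp₂.1.le, hp₂.2.le⟩
  have hp₁' : p₁ ∈ Set.Icc (0 : ℝ) 1 := ⟨hp₁.1.le, hp₁.2.le⟩
  have hZ := cppPartitionFn_pos (d := d) (L := L) M hp₂ hp₁
  have hZ1 := cppPartitionFn_punit (d := d) (L := L) p₂ p₁
  refine holley (cppProb (d := d) (L := L) M p₂ p₁) (cppProb (d := d) (L := L) Unit p₂ p₁) X hX₀
    (fun ω => div_nonneg (cppWeight_nonneg M hp₂' hp₁' ω) hZ.le)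
    (fun ω => div_nonneg (cppWeight_nonneg Unit hp₂' hp₁' ω) (by rw [hZ1]; exact zero_le_one))
    hX ?_ ?_
  · rw [sum_cppProb_eq_one M hp₂ hp₁, sum_cppProb_eq_one Unit hp₂ hp₁]
  · intro a b
    unfold cppProb
    rw [hZ1, div_one, div_one, div_mul_eq_mul_div, div_mul_eq_mul_div,
      div_le_div_iff_of_pos_right hZ]
    exact cppWeight_mul_bernoulli_le M hp₂' hp₁' a b

/-- **Theorem 13 (Eldridge–Forsström–Schweinhart), lower half, PROVED — Bernoulli `(p̂₂, p̂₁) ≤_st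
ρ_{p₂,p₁}`** with `p̂ᵢ = pᵢ/(|M|(1-pᵢ)+pᵢ)` (`= hatParam pᵢ |M|`): for every increasing non-negative
`X`, `Σ_ω X(ω) ψ_{p̂₂,p̂₁}(ω) ≤ Σ_ω X(ω) ρ_M(ω)`; `p₂, p₁ ∈ (0,1)`. By Holley's inequality.
[cite: EldridgeForsstromSchweinhart2026, §1.2 Thm. 13 and §4.3 (Def. 22, Thm. 23, Prop. 24)] -/
theorem sum_mul_bernoulli_hat_le_cppProb {p₂ p₁ : ℝ} (hp₂ : p₂ ∈ Set.Ioo (0 : ℝ) 1)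
    (hp₁ : p₁ ∈ Set.Ioo (0 : ℝ) 1) {X : CppConfig d L → ℝ} (hX₀ : 0 ≤ X) (hX : Monotone X) :
    ∑ ω, X ω * cppProb Unit (hatParam p₂ (Fintype.card M)) (hatParam p₁ (Fintype.card M)) ω ≤
      ∑ ω, X ω * cppProb M p₂ p₁ ω := by
  classical
  have hn1 : (1 : ℝ) ≤ (Fintype.card M : ℝ) := by exact_mod_cast Fintype.card_pos
  have hP₂ := (hatParam_mem_Ioo_and hp₂ hn1).1
  have hP₁ := (hatParam_mem_Ioo_and hp₁ hn1).1
  have hp₂' : p₂ ∈ Set.Icc (0 : ℝ) 1 := ⟨hp₂.1.le, hp₂.2.le⟩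
  have hp₁' : p₁ ∈ Set.Icc (0 : ℝ) 1 := ⟨hp₁.1.le, hp₁.2.le⟩
  have hP₂' : hatParam p₂ (Fintype.card M) ∈ Set.Icc (0 : ℝ) 1 := ⟨hP₂.1.le, hP₂.2.le⟩
  have hP₁' : hatParam p₁ (Fintype.card M) ∈ Set.Icc (0 : ℝ) 1 := ⟨hP₁.1.le, hP₁.2.le⟩
  have hZ := cppPartitionFn_pos (d := d) (L := L) M hp₂ hp₁
  have hZ1 := cppPartitionFn_punit (d := d) (L := L) (hatParam p₂ (Fintype.card M))
    (hatParam p₁ (Fintype.card M))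
  refine holley (cppProb (d := d) (L := L) Unit (hatParam p₂ (Fintype.card M))
      (hatParam p₁ (Fintype.card M))) (cppProb (d := d) (L := L) M p₂ p₁) X hX₀
    (fun ω => div_nonneg (cppWeight_nonneg Unit hP₂' hP₁' ω) (by rw [hZ1]; exact zero_le_one))
    (fun ω => div_nonneg (cppWeight_nonneg M hp₂' hp₁' ω) hZ.le)
    hX ?_ ?_
  · rw [sum_cppProb_eq_one Unit hP₂ hP₁, sum_cppProb_eq_one M hp₂ hp₁]
  · intro a b
    unfold cppProb
    rw [hZ1, div_one, div_one]
    simp only [mul_div_assoc']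
    rw [div_le_div_iff_of_pos_right hZ]
    exact bernoulli_hat_mul_cppWeight_le M hp₂ hp₁ a b

open Classical in
/-- An event probability is the `ρ`-sum of its indicator. [cite: EldridgeForsstromSchweinhart2026, §1.1 Def. 4] -/
theorem cppEventProb_eq_sum_indicator_mul {N : Type*} [AddCommGroup N] [Fintype N] (p₂ p₁ : ℝ)
    (E : Set (CppConfig d L)) :
    cppEventProb N p₂ p₁ E = ∑ ω, (if ω ∈ E then (1 : ℝ) else 0) * cppProb N p₂ p₁ ω := by
  unfold cppEventProb
  exact Finset.sum_congr rfl fun ω _ => by split_ifs <;> simp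

/-- **Theorem 13 for increasing events (the sandwich)**: for every increasing event `E` of pairs
`(P₂, P₁)` and `p₂, p₁ ∈ (0,1)`,
`ψ_{p̂₂,p̂₁}(E) ≤ ρ_{M,p₂,p₁}(E) ≤ ψ_{p₂,p₁}(E)`, `p̂ᵢ = pᵢ/(|M|(1-pᵢ)+pᵢ)`.
[cite: EldridgeForsstromSchweinhart2026, §1.2 Thm. 13] -/
theorem cppEventProb_sandwich {p₂ p₁ : ℝ} (hp₂ : p₂ ∈ Set.Ioo (0 : ℝ) 1)
    (hp₁ : p₁ ∈ Set.Ioo (0 : ℝ) 1) {E : Set (CppConfig d L)} (hE : IsUpperSet E) :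
    cppEventProb Unit (hatParam p₂ (Fintype.card M)) (hatParam p₁ (Fintype.card M)) E ≤
        cppEventProb M p₂ p₁ E ∧
      cppEventProb M p₂ p₁ E ≤ cppEventProb Unit p₂ p₁ E := by
  classical
  have hX₀ : 0 ≤ fun ω : CppConfig d L => if ω ∈ E then (1 : ℝ) else 0 := fun ω => by
    simp only [Pi.zero_apply]; split_ifs <;> norm_num
  have hX : Monotone fun ω : CppConfig d L => if ω ∈ E then (1 : ℝ) else 0 := by
    intro a b hab
    simp only
    by_cases ha : a ∈ E
    · rw [if_pos ha, if_pos (hE hab ha)]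
    · rw [if_neg ha]; split_ifs <;> norm_num
  rw [cppEventProb_eq_sum_indicator_mul, cppEventProb_eq_sum_indicator_mul,
    cppEventProb_eq_sum_indicator_mul]
  exact ⟨sum_mul_bernoulli_hat_le_cppProb M hp₂ hp₁ hX₀ hX, sum_mul_cppProb_le_bernoulli M hp₂ hp₁ hX₀ hX⟩

end Sandwich

end PlaquetteRC

end Literature.MathematicalPhysics.QuantumFieldTheory
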